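import Literature.Analysis.Fourier.LipschitzFourierTail
import Mathlib.Analysis.SpecialFunctions.Complex.Arg
import Mathlib.Analysis.SpecialFunctions.Integrals.Basic
import HarnessLib

/-!
# The tent function of half-width `Δ` on `ℝ/ℤ`: Fourier approximation and integrals

Topic `Literature/Analysis/Fourier`, a consequence file of `LipschitzFourierTail` (Bernstein's
theorem on `ℝ/ℤ`). The **tent** (triangle) `h` of half-width `Δ`,
`tent Δ t = max(1 − |t|/Δ, 0)`, made `1`-periodic (`tentPer Δ t = tent Δ ‖t‖`, `‖t‖` the distance to
the nearest integer) and read on the unit circle through the argument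
(`angTent Δ z = tentPer Δ (arg z/2π)`), is the weight of Heath-Brown's §9 (*Primes represented by
`x³ + 2y³`*, Acta Math. 186 (2001), p. 53: "`h(x) = 1 − Δ⁻¹‖x/2π‖` if `‖x/2π‖ ≤ Δ`, `0` otherwise",
`W(S; Δ, 𝐱) = h(arg(ν₁(S)/ν₁(𝐱))) h(arg(ν₂(S)/ν₂(𝐱)))`) and of Harman's account (*Prime-Detecting
Sieves*, §13.6, (13.6.10): "`h(x) = Δ ∑_n (sin(πnΔ)/(πnΔ))² e^{inx}`"). What the argument of §9
consumes is not the closed form of the coefficients but: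

* `tent`, `tentPer`, `angTent`: values in `[0, 1]`, value `1` at `0`, support within `Δ` of the
  integers (`exists_abs_sub_int_lt_of_tentPer_ne_zero`, `exists_abs_sub_lt_of_angTent_ne_zero`) and the
  explicit formula there (`tentPer_eq_of_abs_sub_int_le`), the polar form
  `angTent Δ (r e^{iψ}) = tentPer Δ (ψ/2π)` for every real `ψ` (`angTent_ofReal_mul_exp`);
* the integrals **`∫_{−Δ}^{Δ} tent = Δ`** (`integral_tent`, `integral_tent_of_le`) and
  **`∫_a^{a+1} tentPer = Δ`** (`integral_tentPer`; these give `I₂(y) = 2πΔ` and the last factor `Δ`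
  of `I(β) = γ₀Δ³V` on p. 60);
* the Fourier side on `ℝ/ℤ` (`tentMap Δ : C(AddCircle 1, ℂ)`, `Δ⁻¹`-Lipschitz, `norm_tentMap_sub_le`):
  coefficients `tentCoeff Δ m` with **`tentCoeff_zero : ĉ(0) = Δ`**, `|ĉ(m)| ≤ 1`, Bernstein's tail
  bound `∑_{K ≤ |m| < 4^J K} |ĉ(m)| ≤ Δ⁻¹/√K` and `∑_{|m|<K} |ĉ(m)| ≤ 1 + Δ⁻¹`, and the **uniform
  trigonometric approximation** `|h(arg z) − ∑_{|m|<K} ĉ(m) z^m| ≤ Δ⁻¹/√K` for `‖z‖ = 1`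
  (`norm_angTent_sub_sum_le`, from `Literature.Analysis.Fourier.norm_sub_trigPoly_le`) — the truncated
  form of (13.6.10) that replaces the absolutely convergent expansion in (9.4)/(13.6.12).

Everything is proved. Deliberately NOT here: the closed form `ĉ(m) = Δ (sin(πmΔ)/(πmΔ))²` (not needed
downstream).

## References

* D. R. Heath-Brown, *Primes represented by `x³ + 2y³`*, Acta Math. 186 (2001), §9 p. 53 (the weight
  `h`, `W(S; Δ, 𝐱)`), (9.4). [cite: HeathBrownActa2001, §9 p. 53]
* G. Harman, *Prime-Detecting Sieves*, LMS Monographs 33, Princeton (2007), §13.6, (13.6.10).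
  [cite: Harman2007, §13.6 (13.6.10)]
* Y. Katznelson, *An Introduction to Harmonic Analysis*, 3rd ed. (2004), Ch. I §6.3 (Bernstein).
  [cite: Katznelson2004, Ch. I, §6.3]

## Mathlib / tree search

Tree: `Literature.Analysis.Fourier.norm_sub_trigPoly_le`, `.sum_quadTail_le'`, `.norm_fourierCoeff_le_one`,
`.sum_union_le_of_nonneg`, `.quadTail` (`LipschitzFourierTail`). Mathlib: `fourierCoeff_eq_intervalIntegral`,
`fourier_coe_apply`, `AddCircle.norm_coe_eq_abs_iff`, `AddCircle.norm_eq`, `Function.Periodic.intervalIntegral_add_eq`,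
`Complex.arg_mul_cos_add_sin_mul_I_eq_toIocMod`, `self_sub_toIocMod`, `Complex.norm_mul_exp_arg_mul_I`,
`Complex.exp_int_mul`, `abs_max_sub_max_le_abs`, `integral_id`. No tent/triangle Fourier file existed
(`lean search 'tent|triangleFun|Fejer'`: only discrete Fejér weights in `Barriers/CriticalPhenomena`).
-/

noncomputable section

open MeasureTheory Complex Finset AddCircle intervalIntegral
open scoped Real

namespace Literature.Analysis.Fourier

/-! ### The tent on `ℝ` -/

/-- **The tent of half-width `Δ`**: `tent Δ t = max(1 − |t|/Δ, 0)` (Harman's `h(2πx)` with `‖x‖`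
the distance to the nearest integer, for `|x| ≤ 1/2`). [cite: Harman2007, §13.6 (13.6.10)] -/
def tent (Δ t : ℝ) : ℝ := max (1 - |t| / Δ) 0

variable {Δ : ℝ}

/-- `tent ≥ 0`. [folklore] -/
theorem tent_nonneg (Δ t : ℝ) : 0 ≤ tent Δ t := le_max_right _ _

/-- `tent ≤ 1` (`Δ > 0`). [folklore] -/
theorem tent_le_one (hΔ : 0 < Δ) (t : ℝ) : tent Δ t ≤ 1 := by
  refine max_le ?_ zero_le_one
  have : 0 ≤ |t| / Δ := div_nonneg (abs_nonneg t) hΔ.le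
  linarith

/-- `|tent| ≤ 1`. [folklore] -/
theorem abs_tent_le_one (hΔ : 0 < Δ) (t : ℝ) : |tent Δ t| ≤ 1 := by
  rw [abs_of_nonneg (tent_nonneg Δ t)]; exact tent_le_one hΔ t

/-- `tent Δ 0 = 1`. [folklore] -/
@[simp] theorem tent_zero (Δ : ℝ) : tent Δ 0 = 1 := by simp [tent]

/-- `tent` is even. [folklore] -/
theorem tent_neg (Δ t : ℝ) : tent Δ (-t) = tent Δ t := by simp [tent]

/-- `tent Δ |t| = tent Δ t`. [folklore] -/
theorem tent_abs (Δ t : ℝ) : tent Δ |t| = tent Δ t := by simp [tent]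

/-- The tent vanishes outside `(−Δ, Δ)` (`Δ > 0`). [folklore] -/
theorem tent_eq_zero (hΔ : 0 < Δ) {t : ℝ} (ht : Δ ≤ |t|) : tent Δ t = 0 := by
  refine max_eq_right ?_
  rw [sub_nonpos, le_div_iff₀ hΔ, one_mul]; exact ht

/-- On `[−Δ, Δ]` the tent is `1 − |t|/Δ`. [folklore] -/
theorem tent_eq (hΔ : 0 < Δ) {t : ℝ} (ht : |t| ≤ Δ) : tent Δ t = 1 - |t| / Δ := by
  refine max_eq_left ?_
  rw [sub_nonneg, div_le_iff₀ hΔ, one_mul]; exact ht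

/-- If the tent is non-zero then `|t| < Δ`. [folklore] -/
theorem abs_lt_of_tent_ne_zero (hΔ : 0 < Δ) {t : ℝ} (ht : tent Δ t ≠ 0) : |t| < Δ := by
  by_contra h; push Not at h; exact ht (tent_eq_zero hΔ h)

/-- **The tent is `Δ⁻¹`-Lipschitz.** [folklore] -/
theorem abs_tent_sub_tent_le (hΔ : 0 < Δ) (s t : ℝ) : |tent Δ s - tent Δ t| ≤ |s - t| / Δ := by
  unfold tent
  calc |max (1 - |s| / Δ) 0 - max (1 - |t| / Δ) 0| ≤ |(1 - |s| / Δ) - (1 - |t| / Δ)| :=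
        abs_max_sub_max_le_abs _ _ _
    _ = |(|s| - |t|)| / Δ := by
        rw [show (1 - |s| / Δ) - (1 - |t| / Δ) = -((|s| - |t|) / Δ) by ring, abs_neg, abs_div,
          abs_of_pos hΔ]
    _ ≤ |s - t| / Δ := div_le_div_of_nonneg_right (abs_abs_sub_abs_le_abs_sub s t) hΔ.le

/-- The tent is continuous. [folklore] -/
theorem continuous_tent (Δ : ℝ) : Continuous (tent Δ) := by
  unfold tent; fun_prop

/-- **`∫_{−Δ}^{Δ} tent = Δ`** (area of the tent). [folklore] -/
theorem integral_tent (hΔ : 0 < Δ) : ∫ t in (-Δ)..Δ, tent Δ t = Δ := by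
  have hint : ∀ a b : ℝ, IntervalIntegrable (tent Δ) volume a b := fun a b =>
    (continuous_tent Δ).intervalIntegrable a b
  rw [← integral_add_adjacent_intervals (hint (-Δ) 0) (hint 0 Δ)]
  have h1 : ∫ t in (-Δ)..0, tent Δ t = ∫ t in (-Δ)..0, (1 + t / Δ) := by
    refine integral_congr fun t ht => ?_
    rw [Set.uIcc_of_le (by linarith), Set.mem_Icc] at ht
    rw [tent_eq hΔ (by rw [abs_le]; constructor <;> linarith), abs_of_nonpos ht.2]; ring
  have h2 : ∫ t in (0:ℝ)..Δ, tent Δ t = ∫ t in (0:ℝ)..Δ, (1 - t / Δ) := by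
    refine integral_congr fun t ht => ?_
    rw [Set.uIcc_of_le hΔ.le, Set.mem_Icc] at ht
    rw [tent_eq hΔ (by rw [abs_le]; constructor <;> linarith), abs_of_nonneg ht.1]
  have hlin : ∀ a b : ℝ, IntervalIntegrable (fun t : ℝ => t / Δ) volume a b := fun a b =>
    (continuous_id.div_const Δ).intervalIntegrable a b
  rw [h1, h2, integral_add intervalIntegrable_const (hlin _ _),
    integral_sub intervalIntegrable_const (hlin _ _), intervalIntegral.integral_const,
    intervalIntegral.integral_const, intervalIntegral.integral_div, intervalIntegral.integral_div,
    integral_id, integral_id]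
  simp only [smul_eq_mul, mul_one]
  field_simp
  ring

/-- `∫_{−a}^{a} tent = Δ` for every `a ≥ Δ` (the tent vanishes outside `[−Δ, Δ]`). [folklore] -/
theorem integral_tent_of_le (hΔ : 0 < Δ) {a : ℝ} (ha : Δ ≤ a) : ∫ t in (-a)..a, tent Δ t = Δ := by
  have hint : ∀ a b : ℝ, IntervalIntegrable (tent Δ) volume a b := fun a b =>
    (continuous_tent Δ).intervalIntegrable a b
  rw [← integral_add_adjacent_intervals (hint (-a) (-Δ)) (hint (-Δ) a),
    ← integral_add_adjacent_intervals (hint (-Δ) Δ) (hint Δ a), integral_tent hΔ]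
  have h1 : ∫ t in (-a)..(-Δ), tent Δ t = 0 := by
    rw [← integral_zero (a := -a) (b := -Δ)]
    refine integral_congr fun t ht => ?_
    rw [Set.uIcc_of_le (by linarith), Set.mem_Icc] at ht
    exact tent_eq_zero hΔ (by rw [abs_of_nonpos (by linarith)]; linarith)
  have h2 : ∫ t in Δ..a, tent Δ t = 0 := by
    rw [← integral_zero (a := Δ) (b := a)]
    refine integral_congr fun t ht => ?_
    rw [Set.uIcc_of_le ha, Set.mem_Icc] at ht
    exact tent_eq_zero hΔ (by rw [abs_of_nonneg (by linarith)]; linarith)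
  rw [h1, h2]; ring

/-! ### The tent on the circle `ℝ/ℤ` and its Fourier approximation -/

/-- **The tent as a continuous function on `ℝ/ℤ`**: `x ↦ tent Δ ‖x‖` (`‖x‖` = distance to `0`,
i.e. to the nearest integer for a representative), complex-valued for Fourier analysis; this is
Harman's `x ↦ h(2πx)`. [cite: Harman2007, §13.6 (13.6.10)] -/
def tentMap (Δ : ℝ) : C(AddCircle (1 : ℝ), ℂ) :=
  ⟨fun x => ((tent Δ ‖x‖ : ℝ) : ℂ),
    Complex.continuous_ofReal.comp ((continuous_tent Δ).comp continuous_norm)⟩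

/-- `tentMap Δ x = tent Δ ‖x‖`. [folklore] -/
theorem tentMap_apply (Δ : ℝ) (x : AddCircle (1 : ℝ)) : tentMap Δ x = ((tent Δ ‖x‖ : ℝ) : ℂ) := rfl

/-- On representatives `t ∈ [−1/2, 1/2]`: `tentMap Δ t = tent Δ t`. [folklore] -/
theorem tentMap_coe {t : ℝ} (ht : |t| ≤ 1 / 2) : tentMap Δ (t : AddCircle (1 : ℝ)) = ((tent Δ t : ℝ) : ℂ) := by
  rw [tentMap_apply, (AddCircle.norm_coe_eq_abs_iff (p := (1 : ℝ)) one_ne_zero).mpr (by simpa using ht),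
    tent_abs]

/-- `‖tentMap Δ x‖ ≤ 1`. [folklore] -/
theorem norm_tentMap_le_one (hΔ : 0 < Δ) (x : AddCircle (1 : ℝ)) : ‖tentMap Δ x‖ ≤ 1 := by
  rw [tentMap_apply, Complex.norm_real, Real.norm_eq_abs]; exact abs_tent_le_one hΔ _

/-- **`tentMap Δ` is `Δ⁻¹`-Lipschitz on `ℝ/ℤ`.** [folklore] -/
theorem norm_tentMap_sub_le (hΔ : 0 < Δ) (x y : AddCircle (1 : ℝ)) :
    ‖tentMap Δ x - tentMap Δ y‖ ≤ 1 / Δ * dist x y := by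
  rw [tentMap_apply, tentMap_apply, ← Complex.ofReal_sub, Complex.norm_real, Real.norm_eq_abs]
  calc |tent Δ ‖x‖ - tent Δ ‖y‖| ≤ |‖x‖ - ‖y‖| / Δ := abs_tent_sub_tent_le hΔ _ _
    _ ≤ ‖x - y‖ / Δ := div_le_div_of_nonneg_right (abs_norm_sub_norm_le x y) hΔ.le
    _ = 1 / Δ * dist x y := by rw [dist_eq_norm]; ring

/-- **The Fourier coefficients of the tent**, `ĉ_Δ(m)` (`= Δ (sin(πmΔ)/(πmΔ))²`, (13.6.10); we only use
`ĉ_Δ(0) = Δ`, `|ĉ_Δ(m)| ≤ 1` and Bernstein's tail bound). [cite: Harman2007, §13.6 (13.6.10)] -/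
def tentCoeff (Δ : ℝ) (m : ℤ) : ℂ := fourierCoeff (tentMap Δ) m

/-- `|ĉ_Δ(m)| ≤ 1`. [folklore] -/
theorem norm_tentCoeff_le_one (hΔ : 0 < Δ) (m : ℤ) : ‖tentCoeff Δ m‖ ≤ 1 :=
  norm_fourierCoeff_le_one (tentMap Δ) (norm_tentMap_le_one hΔ) m

/-- **`ĉ_Δ(0) = Δ`** for `0 < Δ ≤ 1/2` (the area of the tent). [folklore] -/
theorem tentCoeff_zero (hΔ : 0 < Δ) (hΔ2 : Δ ≤ 1 / 2) : tentCoeff Δ 0 = Δ := by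
  rw [tentCoeff, fourierCoeff_eq_intervalIntegral (tentMap Δ) 0 (-(1 / 2)), neg_zero]
  have h : ∀ x ∈ Set.uIcc (-(1 / 2 : ℝ)) (-(1 / 2) + 1),
      fourier 0 (x : AddCircle (1 : ℝ)) • tentMap Δ (x : AddCircle (1 : ℝ)) = ((tent Δ x : ℝ) : ℂ) := by
    intro x hx
    rw [Set.uIcc_of_le (by norm_num), Set.mem_Icc] at hx
    rw [fourier_zero, one_smul, tentMap_coe (by rw [abs_le]; constructor <;> linarith)]
  rw [integral_congr h, intervalIntegral.integral_ofReal, show (-(1 / 2 : ℝ) + 1) = 1 / 2 by norm_num,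
    show (-(1 / 2 : ℝ)) = -(1 / 2) from rfl, integral_tent_of_le hΔ hΔ2]
  simp

/-- **Uniform approximation of the tent by its Fourier partial sums** (Bernstein's theorem for the
`Δ⁻¹`-Lipschitz function `tentMap Δ`, `Literature.Analysis.Fourier.norm_sub_trigPoly_le`): for `K ≥ 1`
and every `x ∈ ℝ/ℤ`, `|tent − ∑_{|m|<K} ĉ_Δ(m) e_m(x)| ≤ Δ⁻¹/√K`. [cite: Katznelson2004, Ch. I, §6.3] -/
theorem norm_tentMap_sub_sum_le (hΔ : 0 < Δ) {K : ℕ} (hK : 1 ≤ K) (x : AddCircle (1 : ℝ)) :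
    ‖tentMap Δ x - ∑ m ∈ Finset.Ioo (-(K : ℤ)) K, tentCoeff Δ m * fourier m x‖ ≤
      1 / Δ / Real.sqrt K :=
  norm_sub_trigPoly_le (tentMap Δ) (by positivity) (norm_tentMap_sub_le hΔ) hK x

/-- **Bernstein's tail bound for the tent coefficients**: `∑_{K ≤ |m| < 4^J K} |ĉ_Δ(m)| ≤ Δ⁻¹/√K`.
[cite: Katznelson2004, Ch. I, §6.3] -/
theorem sum_norm_tentCoeff_tail_le (hΔ : 0 < Δ) {K : ℕ} (hK : 1 ≤ K) (J : ℕ) :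
    ∑ m ∈ quadTail K J, ‖tentCoeff Δ m‖ ≤ 1 / Δ / Real.sqrt K :=
  sum_quadTail_le' (tentMap Δ) (by positivity) (norm_tentMap_sub_le hΔ) hK J

/-- `∑_{|m| < K} |ĉ_Δ(m)| ≤ 1 + Δ⁻¹` (the term `m = 0` and Bernstein's bound with `K = 1`). [folklore] -/
theorem sum_norm_tentCoeff_le (hΔ : 0 < Δ) (K : ℕ) :
    ∑ m ∈ Finset.Ioo (-(K : ℤ)) K, ‖tentCoeff Δ m‖ ≤ 1 + 1 / Δ := by
  classical
  -- `Ioo (-K) K ⊆ {0} ∪ quadTail 1 K` since `K < 4^K`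
  have hsub : Finset.Ioo (-(K : ℤ)) K ⊆ {0} ∪ quadTail 1 K := by
    intro m hm
    rw [Finset.mem_Ioo] at hm
    rw [Finset.mem_union, Finset.mem_singleton, mem_quadTail]
    by_cases h0 : m = 0
    · exact Or.inl h0
    · right
      refine ⟨by simpa using Int.one_le_abs h0, ?_⟩
      have hK4 : (K : ℤ) < 4 ^ K := by exact_mod_cast Nat.lt_pow_self (by norm_num : 1 < 4)
      have hmK : |m| < (K : ℤ) := abs_lt.mpr ⟨hm.1, hm.2⟩
      rw [Nat.cast_one, mul_one]
      exact hmK.trans hK4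
  calc ∑ m ∈ Finset.Ioo (-(K : ℤ)) K, ‖tentCoeff Δ m‖
      ≤ ∑ m ∈ {0} ∪ quadTail 1 K, ‖tentCoeff Δ m‖ :=
        Finset.sum_le_sum_of_subset_of_nonneg hsub fun _ _ _ => norm_nonneg _
    _ ≤ ∑ m ∈ ({0} : Finset ℤ), ‖tentCoeff Δ m‖ + ∑ m ∈ quadTail 1 K, ‖tentCoeff Δ m‖ :=
        sum_union_le_of_nonneg fun _ => norm_nonneg _
    _ ≤ 1 + 1 / Δ := by
        rw [Finset.sum_singleton]
        have h1 := norm_tentCoeff_le_one hΔ 0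
        have h2 := sum_norm_tentCoeff_tail_le hΔ le_rfl K
        rw [Nat.cast_one, Real.sqrt_one, div_one] at h2
        linarith

/-! ### The `1`-periodic tent on `ℝ` and the angular tent on `ℂ^×` -/

/-- **The `1`-periodic tent** `tentPer Δ t = tent Δ ‖t‖` (`‖t‖` the distance from `t` to the nearest
integer): the real-variable form of `tentMap`. This is Harman's `h(2πt)`, and Heath-Brown's `h(x)`
with `x = 2πt` ("`h(x) = 1 − Δ⁻¹‖x/2π‖` if `‖x/2π‖ ≤ Δ`, `0` otherwise", p. 53).
[cite: HeathBrownActa2001, §9 p. 53] -/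
def tentPer (Δ t : ℝ) : ℝ := tent Δ ‖((t : ℝ) : AddCircle (1 : ℝ))‖

/-- `tentMap Δ t = tentPer Δ t`. [folklore] -/
theorem tentMap_coe_eq_tentPer (Δ t : ℝ) : tentMap Δ (t : AddCircle (1 : ℝ)) = ((tentPer Δ t : ℝ) : ℂ) := rfl

/-- `tentPer` is `1`-periodic. [folklore] -/
theorem periodic_tentPer (Δ : ℝ) : Function.Periodic (tentPer Δ) 1 := fun t => by
  simp only [tentPer, AddCircle.coe_add_period]

/-- `tentPer Δ (t + n) = tentPer Δ t` for `n ∈ ℤ`. [folklore] -/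
theorem tentPer_add_int (Δ t : ℝ) (n : ℤ) : tentPer Δ (t + n) = tentPer Δ t := by
  simpa using (periodic_tentPer Δ).int_mul n t

/-- `tentPer Δ (t - n) = tentPer Δ t` for `n ∈ ℤ`. [folklore] -/
theorem tentPer_sub_int (Δ t : ℝ) (n : ℤ) : tentPer Δ (t - n) = tentPer Δ t := by
  simpa using (periodic_tentPer Δ).sub_int_mul_eq n (x := t)

/-- On `[−1/2, 1/2]`: `tentPer Δ t = tent Δ t`. [folklore] -/
theorem tentPer_eq_tent {t : ℝ} (ht : |t| ≤ 1 / 2) : tentPer Δ t = tent Δ t := by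
  rw [tentPer, (AddCircle.norm_coe_eq_abs_iff (p := (1 : ℝ)) one_ne_zero).mpr (by simpa using ht),
    tent_abs]

/-- `0 ≤ tentPer ≤ 1`. [folklore] -/
theorem tentPer_nonneg (Δ t : ℝ) : 0 ≤ tentPer Δ t := tent_nonneg _ _

/-- `tentPer ≤ 1` (`Δ > 0`). [folklore] -/
theorem tentPer_le_one (hΔ : 0 < Δ) (t : ℝ) : tentPer Δ t ≤ 1 := tent_le_one hΔ _

/-- `tentPer Δ 0 = 1`. [folklore] -/
@[simp] theorem tentPer_zero (Δ : ℝ) : tentPer Δ 0 = 1 := by simp [tentPer]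

/-- The periodic tent is continuous. [folklore] -/
theorem continuous_tentPer (Δ : ℝ) : Continuous (tentPer Δ) :=
  (continuous_tent Δ).comp (continuous_norm.comp (AddCircle.continuous_mk' (1 : ℝ)))

/-- **Support of the periodic tent**: if `tentPer Δ t ≠ 0` then `t` is within `Δ` of an integer.
[folklore] -/
theorem exists_abs_sub_int_lt_of_tentPer_ne_zero (hΔ : 0 < Δ) {t : ℝ} (ht : tentPer Δ t ≠ 0) :
    ∃ n : ℤ, |t - n| < Δ := by
  have h := abs_lt_of_tent_ne_zero hΔ ht
  rw [abs_of_nonneg (norm_nonneg _), AddCircle.norm_eq] at h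
  refine ⟨round ((1 : ℝ)⁻¹ * t), by simpa using h⟩

/-- Conversely, within `Δ ≤ 1/2` of an integer the periodic tent is `1 − |t − n|/Δ`. [folklore] -/
theorem tentPer_eq_of_abs_sub_int_le (hΔ : 0 < Δ) (hΔ2 : Δ ≤ 1 / 2) {t : ℝ} {n : ℤ} (h : |t - n| ≤ Δ) :
    tentPer Δ t = 1 - |t - n| / Δ := by
  rw [← tentPer_sub_int Δ t n, tentPer_eq_tent (h.trans hΔ2), tent_eq hΔ h]

/-- **`∫` of the periodic tent over a period is `Δ`** (`0 < Δ ≤ 1/2`). [folklore] -/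
theorem integral_tentPer (hΔ : 0 < Δ) (hΔ2 : Δ ≤ 1 / 2) (a : ℝ) : ∫ t in a..a + 1, tentPer Δ t = Δ := by
  rw [(periodic_tentPer Δ).intervalIntegral_add_eq a (-(1 / 2))]
  have h : ∀ x ∈ Set.uIcc (-(1 / 2 : ℝ)) (-(1 / 2) + 1), tentPer Δ x = tent Δ x := by
    intro x hx
    rw [Set.uIcc_of_le (by norm_num), Set.mem_Icc] at hx
    exact tentPer_eq_tent (by rw [abs_le]; constructor <;> linarith)
  rw [integral_congr h, show (-(1 / 2 : ℝ) + 1) = 1 / 2 by norm_num, integral_tent_of_le hΔ hΔ2]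

/-- **The angular tent** `z ↦ h(arg z)` in Heath-Brown's notation: `tentPer Δ (arg z / 2π)`, the tent of
half-width `Δ` in the angle measured in turns (`W(S; Δ, 𝐱) = h(arg(ν₁(S)/ν₁(𝐱))) h(arg(ν₂(S)/ν₂(𝐱)))`,
p. 53). [cite: HeathBrownActa2001, §9 p. 53] -/
def angTent (Δ : ℝ) (z : ℂ) : ℝ := tentPer Δ (Complex.arg z / (2 * π))

/-- `0 ≤ angTent`. [folklore] -/
theorem angTent_nonneg (Δ : ℝ) (z : ℂ) : 0 ≤ angTent Δ z := tentPer_nonneg _ _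

/-- `angTent ≤ 1` (`Δ > 0`). [folklore] -/
theorem angTent_le_one (hΔ : 0 < Δ) (z : ℂ) : angTent Δ z ≤ 1 := tentPer_le_one hΔ _

/-- `angTent Δ 1 = 1`. [folklore] -/
@[simp] theorem angTent_one (Δ : ℝ) : angTent Δ 1 = 1 := by simp [angTent]

/-- `|arg z / 2π| ≤ 1/2`. [folklore] -/
theorem abs_arg_div_two_pi_le (z : ℂ) : |Complex.arg z / (2 * π)| ≤ 1 / 2 := by
  rw [abs_div, abs_of_pos Real.two_pi_pos, div_le_iff₀ Real.two_pi_pos]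
  have := Complex.abs_arg_le_pi z
  linarith

/-- `angTent Δ z = tent Δ (arg z / 2π)`. [folklore] -/
theorem angTent_eq_tent (Δ : ℝ) (z : ℂ) : angTent Δ z = tent Δ (Complex.arg z / (2 * π)) :=
  tentPer_eq_tent (abs_arg_div_two_pi_le z)

/-- **The angular tent in polar form**: `angTent Δ (r e^{iψ}) = tentPer Δ (ψ/2π)` for `r > 0` and ANY
real `ψ` (not only the principal argument). [folklore] -/
theorem angTent_ofReal_mul_exp {r : ℝ} (hr : 0 < r) (ψ : ℝ) :
    angTent Δ (r * Complex.exp (ψ * Complex.I)) = tentPer Δ (ψ / (2 * π)) := by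
  rw [angTent, Complex.exp_mul_I, Complex.arg_mul_cos_add_sin_mul_I_eq_toIocMod hr]
  have h := self_sub_toIocMod Real.two_pi_pos (-π) ψ
  set n := toIocDiv Real.two_pi_pos (-π) ψ
  have h' : toIocMod Real.two_pi_pos (-π) ψ / (2 * π) = ψ / (2 * π) - n := by
    rw [zsmul_eq_mul] at h
    field_simp
    linarith
  rw [h', tentPer_sub_int]

/-- `angTent Δ (e^{iψ}) = tentPer Δ (ψ/2π)`. [folklore] -/
theorem angTent_exp (ψ : ℝ) : angTent Δ (Complex.exp (ψ * Complex.I)) = tentPer Δ (ψ / (2 * π)) := by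
  simpa using angTent_ofReal_mul_exp (Δ := Δ) one_pos ψ

/-- If `angTent Δ (r e^{iψ}) ≠ 0` (`r > 0`) then `ψ/2π` is within `Δ` of an integer. [folklore] -/
theorem exists_abs_sub_lt_of_angTent_ne_zero (hΔ : 0 < Δ) {r : ℝ} (hr : 0 < r) {ψ : ℝ}
    (h : angTent Δ (r * Complex.exp (ψ * Complex.I)) ≠ 0) : ∃ n : ℤ, |ψ / (2 * π) - n| < Δ := by
  rw [angTent_ofReal_mul_exp hr] at h
  exact exists_abs_sub_int_lt_of_tentPer_ne_zero hΔ h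

/-- The characters of `ℝ/ℤ` at `arg z/2π` are the powers of `z` on the unit circle:
`e_m(arg z/2π) = z^m` for `‖z‖ = 1`. [folklore] -/
theorem fourier_arg_div_two_pi {z : ℂ} (hz : ‖z‖ = 1) (m : ℤ) :
    fourier m (((Complex.arg z / (2 * π) : ℝ)) : AddCircle (1 : ℝ)) = z ^ m := by
  rw [fourier_coe_apply, Complex.ofReal_one, div_one]
  have h : Complex.exp (Complex.arg z * Complex.I) = z := by
    have := Complex.norm_mul_exp_arg_mul_I z
    rwa [hz, Complex.ofReal_one, one_mul] at this
  conv_rhs => rw [← h, ← Complex.exp_int_mul]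
  congr 1
  push_cast
  field_simp

/-- `tentMap Δ (arg z/2π) = angTent Δ z`. [folklore] -/
theorem tentMap_arg_div_two_pi (Δ : ℝ) (z : ℂ) :
    tentMap Δ (((Complex.arg z / (2 * π) : ℝ)) : AddCircle (1 : ℝ)) = ((angTent Δ z : ℝ) : ℂ) := rfl

/-- **The angular tent is a trigonometric polynomial in `z` up to `Δ⁻¹/√K`** (Heath-Brown's use of
(13.6.10)/(9.4), in the truncated form that Bernstein's theorem supplies): for `‖z‖ = 1` and `K ≥ 1`,
`|h(arg z) − ∑_{|m|<K} ĉ_Δ(m) z^m| ≤ Δ⁻¹/√K`. [cite: Harman2007, §13.6 (13.6.10)] -/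
theorem norm_angTent_sub_sum_le (hΔ : 0 < Δ) {K : ℕ} (hK : 1 ≤ K) {z : ℂ} (hz : ‖z‖ = 1) :
    ‖((angTent Δ z : ℝ) : ℂ) - ∑ m ∈ Finset.Ioo (-(K : ℤ)) K, tentCoeff Δ m * z ^ m‖ ≤
      1 / Δ / Real.sqrt K := by
  have h := norm_tentMap_sub_sum_le hΔ hK (((Complex.arg z / (2 * π) : ℝ)) : AddCircle (1 : ℝ))
  rw [tentMap_arg_div_two_pi] at h
  convert h using 4 with m
  rw [fourier_arg_div_two_pi hz]

end Literature.Analysis.Fourier
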